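import Summits.FinalStateConjecture.FinalStateConjecture.Theorems.BartnikGapSettlingBondiBartnikRigidityMarchingLemmaOrientSign
import Summits.FinalStateConjecture.FinalStateConjecture.Theorems.BartnikGapSettlingBondiBartnikRigidityMarchingLemmaCollarSetBasic
import Summits.FinalStateConjecture.FinalStateConjecture.Theorems.BartnikGapSettlingBondiBartnikRigiditySlabCauchyRigidityLensConnected
import Literature.Geometry.Lorentzian.CausalCurveEndpoint
import Literature.Geometry.Lorentzian.CausalityAchronalProofs
import Literature.Geometry.Lorentzian.CausalityPushUp
import Literature.Geometry.Lorentzian.KerrHorizonRegularWaveBoundednessProofs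
import HarnessLib

/-!
# K2b-5 `stub_marchingLemma`, brick 18: the orientation of the boundary collar chart is forced —
# line `direct-method-on-the-cone` (crux `BondiBartnikRigidity`, stmt-FinalStateConjecture-10807)

`IsBoundaryCollarChart` carries no orientation clause, but the orientation of an exact chart `Ψ` of an
open Kerr-side set `Q` with image in `J⁺(C)` IS forced at every point `z ∈ Q` with `r(z) > 2M` below
which a vertical coordinate segment runs inside `Q` down to a FLOOR POINT whose chart image `e` is not in
`I⁺(C)` (`isFutureDirected_of_floor`; in the marching the floor is the slab — `e ∈ C ⊆ ι(X)`, achronal —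
or the roof — `e ∈ ∂J⁺(C)`): were `dΦ V` past-directed at `z`, it would be so along the segment
(constancy of the orientation character, `OrientK`), the chart image of the segment run DOWNWARDS would
be a future timelike curve of `𝒮` from `Φ z ∈ J⁺(C)` with future endpoint `e`, forcing `e ∈ I⁺(C)`.
For the inner points (`r ≤ 2M`, small `t*`) the orientation is then propagated through the connected
low cylinder `{0 < t* < η, r < 3M}` (`isPreconnected_lowCylinder`, from `F1Route.isConnected_slabW`).

References: O'Neill 1983, Ch. 5, p. 145, Ch. 14, Cor. 14.1 [ONeill1983]; Dafermos–Rodnianski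
arXiv:0811.0354, §5.1 [DafermosRodnianski2008].  No definitions, no named facts.
-/

noncomputable section

-- D-0017: single-problem summit, `Summit.<S>.<S>.…` by design (cf. lakefile `weak.linter.dupNamespace`).
set_option linter.dupNamespace false
set_option maxSynthPendingDepth 3

open Set Filter Function Topology TopologicalSpace Bundle
open Literature.Geometry.Lorentzian
open scoped Manifold ContDiff Topology ENNReal
open Summit.FinalStateConjecture.FinalStateConjecture.Theorems.SwallowTheDatum.KerrShieldedSettles.CollarCauchy
  (velocity_eq_deriv)

namespace Summit.FinalStateConjecture.FinalStateConjecture.Theorems.BondiBartnikRigidity.DirectMethod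

namespace OrientK

open ChartData (lab_mem_pullK_iff contMDiffAt_chart val_mfderiv_chart eq_zero_of_mfderiv_chart_eq_zero)
open FutureK (translate_mem_region)

variable [Kerr.Facts] {𝒮 : Spacetime.{0} 4} {mo : lorentzGroup × E4} {M a : ℝ} {B : ModelBackground}
  {Ψ : B.domain → 𝒮.carrier} {lab : Kerr.region a M → B.domain} {Q : Set (Kerr.region a M)}

/-- **Constancy of the orientation character, positive sign**: if `g(T, dΦ V) > 0` at one point of a
preconnected `A ⊆ Q` then at all of its points. [cite: ONeill1983, Ch. 5, p. 145] -/
theorem orientSign_pos_of_isPreconnected (hM : 0 < M)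
    (hlab : ∀ z, (lab z : E4) = (mo.1 : E4 ≃L[ℝ] E4) z.1 + mo.2)
    (hQ : IsOpen Q) (hB : B = starBackground mo.1 mo.2 M a (fun x => Kerr.radius a (poincareInv mo.1 mo.2 x)))
    (hs : ContMDiffOn 𝓘(ℝ, E4) (𝓡 4) ∞ Ψ (pullK mo M a B Q))
    (hd : supCkENorm (Subtype.val '' pullK mo M a B Q) 0 (𝒮.deviationExtend B Ψ) ≤ 0)
    {A : Set (Kerr.region a M)} (hA : IsPreconnected A) (hAQ : A ⊆ Q)
    {z₁ : Kerr.region a M} (hz₁ : z₁ ∈ A)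
    (h₁ : 0 < 𝒮.metric.val ((Ψ ∘ lab) z₁) (𝒮.timeOrientation.vectorField ((Ψ ∘ lab) z₁))
      (mfderiv 𝓘(ℝ, E4) (𝓡 4) (Ψ ∘ lab) z₁ (Kerr.timeVector M a z₁.1)))
    {z : Kerr.region a M} (hz : z ∈ A) :
    0 < 𝒮.metric.val ((Ψ ∘ lab) z) (𝒮.timeOrientation.vectorField ((Ψ ∘ lab) z))
      (mfderiv 𝓘(ℝ, E4) (𝓡 4) (Ψ ∘ lab) z (Kerr.timeVector M a z.1)) := by
  set Q' : Opens (Kerr.region a M) := ⟨Q, hQ⟩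
  set f : Q' → ℝ := fun q => 𝒮.metric.val (Ψ (lab q.1)) (𝒮.timeOrientation.vectorField (Ψ (lab q.1)))
    (mfderiv 𝓘(ℝ, E4) (𝓡 4) (Ψ ∘ lab) q.1 (Kerr.timeVector M a q.1.1)) with hf
  have hfc : Continuous f := continuous_orientSign hlab hQ hB hs
  set A' : Set Q' := Subtype.val ⁻¹' A with hA'
  have hA'c : IsPreconnected A' := by
    have himg : Subtype.val '' A' = A := by
      ext y; constructor
      · rintro ⟨q, hq, rfl⟩; exact hq
      · intro hy; exact ⟨⟨y, hAQ hy⟩, hy, rfl⟩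
    have h := hA
    rw [← himg] at h
    exact (IsInducing.subtypeVal.isPreconnected_image (s := A')).1 h
  have hpos₁ : 0 < f ⟨z₁, hAQ hz₁⟩ := h₁
  by_contra hle
  push Not at hle
  obtain ⟨q, -, hq0⟩ := hA'c.intermediate_value₂ (show (⟨z, hAQ hz⟩ : Q') ∈ A' from hz)
    (show (⟨z₁, hAQ hz₁⟩ : Q') ∈ A' from hz₁) hfc.continuousOn continuousOn_const hle hpos₁.le
  exact orientSign_ne_zero hM hlab hQ hB hs hd q.2 hq0

/-- **The orientation of an exact chart is forced above a floor point** (see the module docstring).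
[cite: DafermosRodnianski2008, §5.1] -/
theorem isFutureDirected_of_floor (hM : 0 < M)
    (hlab : ∀ z, (lab z : E4) = (mo.1 : E4 ≃L[ℝ] E4) z.1 + mo.2)
    (hQ : IsOpen Q) (hB : B = starBackground mo.1 mo.2 M a (fun x => Kerr.radius a (poincareInv mo.1 mo.2 x)))
    (hs : ContMDiffOn 𝓘(ℝ, E4) (𝓡 4) ∞ Ψ (pullK mo M a B Q))
    (hd : supCkENorm (Subtype.val '' pullK mo M a B Q) 0 (𝒮.deviationExtend B Ψ) ≤ 0)
    {C : Set 𝒮.carrier} (himg : Ψ '' pullK mo M a B Q ⊆ 𝒮.metric.causalFuture 𝒮.timeOrientation C)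
    {z : Kerr.region a M} (hr : 2 * M < Kerr.radius a z.1) {s' : ℝ} (hs' : 0 < s')
    (hseg : ∀ u, 0 ≤ u → u < s' → (⟨z.1 + (-u) • E4.basisVector 0, translate_mem_region z (-u)⟩ : Kerr.region a M) ∈ Q)
    {e : 𝒮.carrier}
    (hcont : Tendsto (fun u => Ψ (lab ⟨z.1 + (-u) • E4.basisVector 0, translate_mem_region z (-u)⟩)) (𝓝[<] s') (𝓝 e))
    (he : e ∉ 𝒮.metric.chronologicalFuture 𝒮.timeOrientation C) :
    𝒮.timeOrientation.IsFutureDirected (mfderiv 𝓘(ℝ, E4) (𝓡 4) (Ψ ∘ lab) z (Kerr.timeVector M a z.1)) := by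
  have hn1 : (1 : ℕ∞ω) ≤ (∞ : ℕ∞ω) := by exact_mod_cast le_top
  set T : ℝ → Kerr.region a M := fun u => ⟨z.1 + (-u) • E4.basisVector 0, translate_mem_region z (-u)⟩ with hT
  have hT0 : T 0 = z := Subtype.ext (by simp [hT])
  have hTr : ∀ u, Kerr.radius a (T u).1 = Kerr.radius a z.1 := fun u => Kerr.radius_add_time_smul_basisVector a z.1 _
  -- cone facts at points of `Q`
  have hiso : ∀ {w : Kerr.region a M}, w ∈ Q → ∀ v v' : E4, 𝒮.metric.val ((Ψ ∘ lab) w)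
      (mfderiv 𝓘(ℝ, E4) (𝓡 4) (Ψ ∘ lab) w v) (mfderiv 𝓘(ℝ, E4) (𝓡 4) (Ψ ∘ lab) w v') = Kerr.bilin M a w.1 v v' :=
    fun hw v v' => val_mfderiv_chart hlab hQ hB hs hd hw v v'
  have hVt : ∀ {w : Kerr.region a M}, w ∈ Q →
      𝒮.metric.IsTimelike (mfderiv 𝓘(ℝ, E4) (𝓡 4) (Ψ ∘ lab) w (Kerr.timeVector M a w.1)) := fun {w} hw => by
    show 𝒮.metric.val _ _ _ < 0
    rw [hiso hw]; exact Kerr.bilin_timeVector_timeVector_neg hM.le a (Kerr.radius_pos_of_mem_region w.2)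
  have hzQ : z ∈ Q := by rw [← hT0]; exact hseg 0 le_rfl hs'
  -- dichotomy at `z`
  by_contra hnot
  have hpos : 0 < 𝒮.metric.val ((Ψ ∘ lab) z) (𝒮.timeOrientation.vectorField ((Ψ ∘ lab) z))
      (mfderiv 𝓘(ℝ, E4) (𝓡 4) (Ψ ∘ lab) z (Kerr.timeVector M a z.1)) := by
    rcases 𝒮.timeOrientation.isFutureDirected_or_isPastDirected_of_isCausal (hVt hzQ).isCausal with h | h
    · exact absurd h hnot
    · exact h.2
  -- hence past-directed along the whole segment
  set A : Set (Kerr.region a M) := T '' Ico 0 s' with hA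
  have hTc : Continuous T := CollarK.continuous_translate.comp (continuous_neg.prodMk continuous_const)
  have hAc : IsPreconnected A := isPreconnected_Ico.image T hTc.continuousOn
  have hAQ : A ⊆ Q := by rintro _ ⟨u, hu, rfl⟩; exact hseg u hu.1 hu.2
  have hzA : z ∈ A := ⟨0, ⟨le_rfl, hs'⟩, hT0⟩
  have hposA : ∀ u ∈ Ico (0 : ℝ) s', 0 < 𝒮.metric.val ((Ψ ∘ lab) (T u))
      (𝒮.timeOrientation.vectorField ((Ψ ∘ lab) (T u)))
      (mfderiv 𝓘(ℝ, E4) (𝓡 4) (Ψ ∘ lab) (T u) (Kerr.timeVector M a (T u).1)) := fun u hu =>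
    orientSign_pos_of_isPreconnected hM hlab hQ hB hs hd hAc hAQ hzA hpos ⟨u, hu, rfl⟩
  -- the downward chart image `c u = Φ (T u)` is a FUTURE timelike curve of `𝒮` on `[0, s')`
  set c : ℝ → 𝒮.carrier := fun u => Ψ (lab (T u)) with hc
  have hTd : ∀ u, HasDerivAt (fun u => ((T u) : E4)) (-(E4.basisVector 0)) u := fun u => by
    show HasDerivAt (fun u => z.1 + (-u) • E4.basisVector 0) (-(E4.basisVector 0)) u
    have := (((hasDerivAt_id u).neg).smul_const (E4.basisVector 0)).const_add z.1
    simpa using this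
  have hTmd : ∀ u, MDifferentiableAt 𝓘(ℝ, ℝ) 𝓘(ℝ, E4) T u := fun u =>
    (mdifferentiableAt_subtypeVal_comp_curve_iff (I := 𝓘(ℝ, E4)) (Kerr.region a M)).1
      (mdifferentiableAt_iff_differentiableAt.mpr (hTd u).differentiableAt)
  have hTvel : ∀ u, (velocity 𝓘(ℝ, E4) T u : E4) = -(E4.basisVector 0) := fun u => by
    rw [velocity_eq_deriv]; exact (hTd u).deriv
  have hcurve : 𝒮.metric.IsFutureTimelikeCurveOn 𝒮.timeOrientation c (Ico 0 s') := by
    intro u hu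
    have hwQ : T u ∈ Q := hseg u hu.1 hu.2
    obtain ⟨hΦat, -⟩ := contMDiffAt_chart hlab hQ hB hs hwQ
    have hcomp : c = (Ψ ∘ lab) ∘ T := rfl
    have hvel : velocity (𝓡 4) c u = mfderiv 𝓘(ℝ, E4) (𝓡 4) (Ψ ∘ lab) (T u) (-(E4.basisVector 0)) := by
      unfold velocity
      rw [hcomp, mfderiv_comp u (hΦat.mdifferentiableAt (by simp)) (hTmd u)]
      show mfderiv 𝓘(ℝ, E4) (𝓡 4) (Ψ ∘ lab) (T u) (mfderiv 𝓘(ℝ, ℝ) 𝓘(ℝ, E4) T u 1) = _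
      congr 1; exact hTvel u
    have hwr : 0 < Kerr.radius a (T u).1 := Kerr.radius_pos_of_mem_region (T u).2
    have h00 : Kerr.bilin M a (T u).1 (E4.basisVector 0) (E4.basisVector 0) < 0 := by
      rw [Kerr.bilin_apply, Minkowski.bilin_basisVector_zero, Kerr.nullCovector_basisVector_zero]
      have hH := Kerr.scalarH_le_div hM.le a hwr
      rw [hTr] at hH
      have : M / Kerr.radius a z.1 < 1 / 2 := by rw [div_lt_iff₀ (by linarith)]; linarith
      nlinarith
    have hneg : mfderiv 𝓘(ℝ, E4) (𝓡 4) (Ψ ∘ lab) (T u) (-(E4.basisVector 0)) =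
        -(mfderiv 𝓘(ℝ, E4) (𝓡 4) (Ψ ∘ lab) (T u) (E4.basisVector 0)) := ContinuousLinearMap.map_neg _ _
    -- `dΦ e₀` is timelike, in the (past) cone of `dΦ V`
    have he0t : 𝒮.metric.IsTimelike (mfderiv 𝓘(ℝ, E4) (𝓡 4) (Ψ ∘ lab) (T u) (E4.basisVector 0)) := by
      show 𝒮.metric.val _ _ _ < 0; rw [hiso hwQ]; exact h00
    have hVe0 : 𝒮.metric.val ((Ψ ∘ lab) (T u)) (mfderiv 𝓘(ℝ, E4) (𝓡 4) (Ψ ∘ lab) (T u) (Kerr.timeVector M a (T u).1))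
        (mfderiv 𝓘(ℝ, E4) (𝓡 4) (Ψ ∘ lab) (T u) (E4.basisVector 0)) < 0 := by
      rw [hiso hwQ, Kerr.bilin_timeVector hwr]; simp [E4.basisVector]
    set T𝒮 := 𝒮.timeOrientation.vectorField ((Ψ ∘ lab) (T u)) with hT𝒮
    have hTt : 𝒮.metric.IsTimelike (-T𝒮) := by
      show 𝒮.metric.val _ (-T𝒮) (-T𝒮) < 0
      simp only [map_neg, neg_apply, neg_neg]
      exact 𝒮.timeOrientation.isTimelike _
    have hTV : 𝒮.metric.val ((Ψ ∘ lab) (T u))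
        (mfderiv 𝓘(ℝ, E4) (𝓡 4) (Ψ ∘ lab) (T u) (Kerr.timeVector M a (T u).1)) (-T𝒮) < 0 := by
      rw [map_neg, 𝒮.metric.symm]; linarith [hposA u hu]
    have key := 𝒮.metric.val_lt_zero_of_isCausal (hVt hwQ) hTt hTV he0t.isCausal hVe0
    -- `g(T, dΦ e₀) > 0`, so `g(T, dΦ(−e₀)) < 0`
    have hsign : 𝒮.metric.val ((Ψ ∘ lab) (T u)) T𝒮
        (mfderiv 𝓘(ℝ, E4) (𝓡 4) (Ψ ∘ lab) (T u) (-(E4.basisVector 0))) < 0 := by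
      rw [hneg, map_neg]
      simp only [map_neg, neg_apply] at key
      linarith
    have hvv : 𝒮.metric.val ((Ψ ∘ lab) (T u)) (mfderiv 𝓘(ℝ, E4) (𝓡 4) (Ψ ∘ lab) (T u) (-(E4.basisVector 0)))
        (mfderiv 𝓘(ℝ, E4) (𝓡 4) (Ψ ∘ lab) (T u) (-(E4.basisVector 0))) < 0 := by
      rw [hiso hwQ]; simp only [map_neg, neg_apply, neg_neg]; exact h00
    refine ⟨(hΦat.mdifferentiableAt (by simp)).comp u (hTmd u), ?_, ⟨?_, ?_⟩, ?_⟩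
    · rw [hvel]; exact hvv
    · rw [hvel]; exact hvv.le
    · rw [hvel, hneg]; intro h0
      have := eq_zero_of_mfderiv_chart_eq_zero hlab hQ hB hs hd hwQ (neg_eq_zero.1 h0)
      have h1 := congrArg (fun v : E4 => v 0) this
      simp [E4.basisVector] at h1
    · rw [hvel]; exact hsign
  -- future endpoint `e`, so `e ∈ J⁺(c(s'/2))` with `c(s'/2) ∈ I⁺(C)`: contradiction
  haveI : Fact ((1 : ℕ∞ω) ≤ (∞ : ℕ∞ω)) := ⟨by exact_mod_cast le_top⟩
  haveI : 𝒮.metric.toPseudoRiemannianMetric.HasLeviCivita := PseudoRiemannianMetric.hasLeviCivita _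
  haveI : CovariantDerivative.ContMDiffCovariantDerivative 𝒮.metric.leviCivita 1 :=
    ⟨𝒮.metric.toPseudoRiemannianMetric.isLocallyContMDiff_leviCivita_holds 1
      (by rw [show ((1 : ℕ∞) : ℕ∞ω) + 1 = 2 by norm_num]; exact WithTop.coe_le_coe.2 le_top)
      univ isOpen_univ⟩
  have hend : HasFutureEndpoint c (Ico 0 s') e := (hasFutureEndpoint_Ico_iff hs').2 hcont
  have hmid : (s' / 2) ∈ Ico (0 : ℝ) s' := ⟨by linarith, by linarith⟩
  have hJ := LorentzianMetric.mem_causalPast_of_hasFutureEndpoint 𝒮.timeOrientation le_rfl ordConnected_Ico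
    hcurve.isFutureCausalCurveOn hend hmid
  rw [LorentzianMetric.mem_causalPast_singleton_iff] at hJ
  have h0 : c 0 ∈ 𝒮.metric.causalFuture 𝒮.timeOrientation C :=
    himg ⟨lab (T 0), (lab_mem_pullK_iff hlab _).2 (hseg 0 le_rfl hs'), rfl⟩
  have hI : c (s' / 2) ∈ 𝒮.metric.chronologicalFuture 𝒮.timeOrientation C := by
    rw [← LorentzianMetric.chronologicalFuture_causalFuture_eq_of_boundaryless hn1 C]
    exact ⟨c 0, h0, c, 0, s' / 2, by linarith, hcurve.mono (Icc_subset_Ico_right (by linarith)), rfl, rfl⟩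
  exact he (LorentzianMetric.mem_chronologicalFuture_of_mem_chronologicalFuture_of_mem_causalFuture_set hn1 hI hJ)

/-! ### The low cylinder is connected -/

omit [Kerr.Facts] in
/-- **The low cylinder `{0 < t* < η, r < 3M}` of the chart is preconnected** (image of
`(0, η) × {M < r < 3M}` under `(t, y) ↦ (t, y)`; the annulus is connected, `F1Route.isConnected_slabW`).
[cite: ONeill1995, Ch. 2, §2.1] -/
theorem isPreconnected_lowCylinder [Kerr.Facts] (hM : 0 < M) (η : ℝ) :
    IsPreconnected {y : Kerr.region a M | 0 < y.1 0 ∧ y.1 0 < η ∧ Kerr.radius a y.1 < 3 * M} := by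
  have hmax : max M 0 = M := max_eq_left hM.le
  set A₀ : Set E3 := {y | M < Kerr.radius a (E4.ofTimeSpace 0 y) ∧ Kerr.radius a (E4.ofTimeSpace 0 y) < 3 * M}
  have hA₀c : IsPreconnected A₀ := by
    have h := ((F1Route.isConnected_slabW a hM).image _ continuous_subtype_val.continuousOn).isPreconnected
    have heq : Subtype.val '' (F1Route.slabW M a : Set (Kerr.slice a M)) = A₀ := by
      ext y; constructor
      · rintro ⟨w, hw, rfl⟩
        refine ⟨?_, hw⟩
        have := w.2; rw [Kerr.mem_slice_iff_ofTimeSpace_mem_region, Kerr.mem_region, hmax] at this; exact this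
      · rintro ⟨h1, h2⟩
        exact ⟨⟨y, by rw [Kerr.mem_slice_iff_ofTimeSpace_mem_region, Kerr.mem_region, hmax]; exact h1⟩, h2, rfl⟩
    rwa [heq] at h
  -- the product set and its image in `E4`
  have hprod : IsPreconnected (Ioo (0 : ℝ) η ×ˢ A₀) := isPreconnected_Ioo.prod hA₀c
  set f : ℝ × E3 → E4 := fun q => E4.ofTimeSpace q.1 q.2
  have hfc : Continuous f := by
    have h1 : Continuous fun q : ℝ × E3 => E4.ofTimeSpace 0 q.2 + q.1 • E4.basisVector 0 :=
      ((E4.continuous_ofTimeSpace 0).comp continuous_snd).add (continuous_fst.smul continuous_const)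
    refine h1.congr fun q => ?_
    show E4.ofTimeSpace 0 q.2 + q.1 • E4.basisVector 0 = E4.ofTimeSpace q.1 q.2
    rw [Kerr.ofTimeSpace_add_smul_basisVector_zero, zero_add]
  have himgE : IsPreconnected (f '' (Ioo (0 : ℝ) η ×ˢ A₀)) := hprod.image f hfc.continuousOn
  have hsub : f '' (Ioo (0 : ℝ) η ×ˢ A₀) ⊆ (Kerr.region a M : Set E4) := by
    rintro _ ⟨⟨t, y⟩, ⟨-, hy⟩, rfl⟩
    show E4.ofTimeSpace t y ∈ Kerr.region a M
    rw [Kerr.mem_region, hmax, Kerr.radius_eq_of_spatial_eq a (y := E4.ofTimeSpace 0 y)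
      (by rw [E4.spatial_ofTimeSpace, E4.spatial_ofTimeSpace])]
    exact hy.1
  have heq : Subtype.val '' {y : Kerr.region a M | 0 < y.1 0 ∧ y.1 0 < η ∧ Kerr.radius a y.1 < 3 * M} =
      f '' (Ioo (0 : ℝ) η ×ˢ A₀) := by
    ext v; constructor
    · rintro ⟨y, ⟨h1, h2, h3⟩, rfl⟩
      refine ⟨⟨y.1 0, E4.spatial y.1⟩, ⟨⟨h1, h2⟩, ?_, ?_⟩, ?_⟩
      · rw [Kerr.radius_ofTimeSpace_spatial]; exact Kerr.lt_radius_of_mem_region y.2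
      · rw [Kerr.radius_ofTimeSpace_spatial]; exact h3
      · exact E4.ofTimeSpace_time_spatial y.1
    · rintro ⟨⟨t, y⟩, ⟨ht, hy⟩, rfl⟩
      refine ⟨⟨E4.ofTimeSpace t y, hsub ⟨⟨t, y⟩, ⟨ht, hy⟩, rfl⟩⟩, ⟨?_, ?_, ?_⟩, rfl⟩
      · show 0 < (E4.ofTimeSpace t y) 0; rw [E4.ofTimeSpace_apply_zero]; exact ht.1
      · show (E4.ofTimeSpace t y) 0 < η; rw [E4.ofTimeSpace_apply_zero]; exact ht.2
      · show Kerr.radius a (E4.ofTimeSpace t y) < 3 * M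
        rw [Kerr.radius_eq_of_spatial_eq a (y := E4.ofTimeSpace 0 y)
          (by rw [E4.spatial_ofTimeSpace, E4.spatial_ofTimeSpace])]; exact hy.2
  rw [← heq] at himgE
  exact IsInducing.subtypeVal.isPreconnected_image.1 himgE

end OrientK

/-- **Registered bookkeeping sub-goal `stub_kerrLowCylinderConnected` of the line** (brick of the landing of
K2b-5 `stub_marchingLemma`): the low cylinder `{0 < t* < η, r < 3M}` of the Kerr star chart is preconnected
(anchor of this file, whose content is the forcing of the orientation of exact charts above floor points,
`OrientK.isFutureDirected_of_floor`). [cite: ONeill1995, Ch. 2, §2.1] -/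
theorem stub_kerrLowCylinderConnected [Kerr.Facts] : ∀ (M a : ℝ), 0 < M → ∀ η : ℝ,
    IsPreconnected {y : Kerr.region a M | 0 < y.1 0 ∧ y.1 0 < η ∧ Kerr.radius a y.1 < 3 * M} :=
  fun _ _ hM η => OrientK.isPreconnected_lowCylinder hM η

end Summit.FinalStateConjecture.FinalStateConjecture.Theorems.BondiBartnikRigidity.DirectMethod

end
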